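import Summits.QuantumFields.YangMills.Theorems.FluctuationComparisonRegPrIntLOrganTangentSquareOfTubeHolomorphic
import Literature.MathematicalPhysics.QuantumFieldTheory.Balaban1983to89.B13RealSliceEntryLetters
import HarnessLib

/-!
# Crux `FluctuationComparisonRegPrIntL` (stmt-QuantumFields-20520, rung R3), PATH-B organ (covariant organ of record, RULING №56), group (I-curv) ∕ SPEC (xv) —
# (L58) «THE CORNER INVERSES OF (xv) FROM REAL COERCIVITY»: the twelve corner-inverse letters of px19 g23's ✓p828173
# `norm_doubleDiff_inv_mul_le_of_tubeHolo` (two-sided inverses `A_U, A_V, A_Y, A_Z` of the complexified fluctuation operator at the four REAL corners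
# of the near square, one norm bound `a`) are STRUCK in favour of print's REAL input (W-coer) «the real fluctuation operator at a real small background is
# `γK`-coercive» ([Balaban1985BackgroundPropagators] Thm 3.11 p.416 ∕ Thm 3.12 p.423 ∕ p.428) read at the four corners through centre identities (W-read0):
# in `R := Matrix n n ℂ` with the `L²`-operator norm, `K(ι W)⁻¹` is then a two-sided inverse with `‖K(ι W)⁻¹‖ ≤ γK⁻¹` (Lax–Milgram) — so `a := γK⁻¹`.

Cell `ym3-torus` (YM ladder rung R3 = continuum `SU(2)` Yang–Mills on the three-torus — a RUNG: NOT d = 4, NOT infinite volume, NOT a mass gap, NOT Clay).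
Width seat `ym-ust-20520-w5` (gen 27), `--kind proof --supports stmt-QuantumFields-20520 --as helper`, count-neutral, DEFINITION-FREE, default heartbeats,
no registry ∕ binder ∕ `Lines/` edit.  Over ✓p828173 `…OrganTangentSquareOfTubeHolomorphic` (px19 g23; `[NormedRing R] [NormedAlgebra ℂ R]` abstract), lit
✓`B13RealSliceEntryLetters` (`accretive_of_coercive_sub`, T-58.4), lit ✓`B13Sqrt27Accretive` (`resolvent_bound_of_accretive`), lit ✓`QGQInverse` (`Coercive`),
Mathlib `Matrix.Norms.L2Operator` (`Matrix.l2_opNorm_def`, `instL2OpNormedRing`, `instL2OpNormedAlgebra`).  Sibling of (L57) `…OrganTangentDwhiteOfRealCoercive`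
(the same (W-coer) letter serves D0's (Dwhite∣MW) margin): UV3-NODE §92.2 L2-a («`a` = corner inverse bound of ✓p828173; `m` of ✓p827976») is ONE printed REAL
statement feeding both.

THE LETTERS (hypothesis texts).  ✓p828173's (W-tube) `hK hKM hH hHM` (tube holomorphy + bounds of `K, H` — UV3-NODE §92.2 L2-c) and the real near square
`U, V, Y, Z` VERBATIM; NEW in place of `{AU AV AY AZ} (hlU hrU hlV hrV hlY hrY hlZ hrZ) (hAU hAV hAY hAZ)`:
* (W-read0)×4 «`K (ι W) = (Kr W).map ofReal`», `W ∈ {U, V, Y, Z}` — at an embedded REAL configuration the complexified operator READS the real fluctuation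
  operator `Kr W : Matrix n n ℝ` ([Balaban1987RG1] (1.5) p.261 «analytic functions of the configurations» restricted to the real ones);
* (W-coer)×4 «`Coercive (Kr W) γK`», ONE `γK > 0` — [Balaban1985BackgroundPropagators] Thm 3.11 ∕ p.428 IN ITS PRINTED, REAL FORM (UV3-NODE §92.2 L2-a; the
  curved multi-level edition on the T³ record is MISSING in the tree — flat k-level ✓`B6QGGQCoerciveMultiLevelTorus`, curved one step ✓`B9Thm311SmallFieldCoercivity*`
  are its typed neighbours); NOT discharged here.
INHABITATION (★★OWNER RULING №100): LAW-FREE — statements about the chart object `K` at four real configurations; no fibre law, no score, no cross-law object.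

WHAT (sorry-free, def-free; `n` a finite index; `Matrix n n ℂ` normed by `Matrix.Norms.L2Operator`).
* §0 [folklore] in the lane's accretivity TEXT `∀ v, m·Σ‖v i‖² ≤ (Σ star (v i)·(A *ᵥ v) i).re` (✓p827976 ∕ lit T-58): `accretive_map_of_coercive` (`Coercive T₀ γ` ⟹
  `T₀.map ofReal` is `γ`-accretive: lit ✓`accretive_of_coercive_sub` at ZERO deviation), `isUnit_det_of_accretive` (lit ✓`resolvent_bound_of_accretive` at spectral
  parameter `0`), `sq_sum_le_of_accretive` (`m²·Σ‖v i‖² ≤ Σ‖(A v) i‖²`, Cauchy–Schwarz), ★`l2_opNorm_inv_le_of_accretive` (`‖A⁻¹‖ ≤ m⁻¹`: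
  `ContinuousLinearMap.opNorm_le_bound` on `toEuclideanLin A⁻¹`, the square bound at `v := A⁻¹ψ`), ★★`cornerInverse_of_coercive` (`Coercive T₀ γ`, `0 < γ` ⟹
  `(T₀.map ofReal)⁻¹ * T₀.map ofReal = 1 ∧ T₀.map ofReal * (T₀.map ofReal)⁻¹ = 1 ∧ ‖(T₀.map ofReal)⁻¹‖ ≤ γ⁻¹` — EXACTLY one corner's `(hl, hr, hA)` triple at `a := γ⁻¹`).
  (`l2_opNorm_inv_le_of_accretive` is the (xv)-currency twin of the T⁴ spine's `CoerciveInverseTower.opNorm_inv_le_of_coercive` — adapted, not imported: that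
  module lives outside `Theorems/`.)
* §1 ★★★`norm_doubleDiff_inv_mul_le_of_tubeHolo_coercive` — ✓p828173 `norm_doubleDiff_inv_mul_le_of_tubeHolo` at `R := Matrix n n ℂ` with the twelve corner
  letters DELETED and `(hγK : 0 < γK)` + `(Kr : GaugeField P j SU(2) → Matrix n n ℝ)` + (W-read0)×4 `hKU hKV hKY hKZ` + (W-coer)×4 `hcU hcV hcY hcZ` in their place;
  CONCLUSION = ✓p828173's with `A_W := (K (ι W))⁻¹` and `a := γK⁻¹` — the explicit ✓p827764 polynomial VERBATIM in `γK⁻¹`.  Proof: §0 at the four corners,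
  `rw [← hKW]`, then ✓p828173 by name.
NET: (I-curv)'s layer-(2) letter list loses «corner inverse bound `a`» as an independent letter — it is (W-coer) REAL read at the four corners; with (L57), L2-a
feeds BOTH D0's (Dwhite∣MW) margin and (xv)'s corners from ONE printed real statement.  WHAT STAYS FOR THE DISCHARGER (unchanged): (W-coer) itself, the tube
holomorphy ∕ bounds of `K, H` (L2-c), the m-UNIFORMITY of `(MK, MH, r, γK)`, the `tdist`-decay after the trace (L2-e).

HONEST FRAMING: [folklore] finite-dimensional linear algebra (Lax–Milgram for an accretive matrix) + a re-issue of a landed door between HYPOTHESIS letters;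
nothing of Bałaban's operators is constructed or asserted; (W-coer), (W-read0), L2-b∕c∕e, D0, (I-curv), (I-cov), KER′ letters, rows v0.1–v0.4ᴱ UNDISCHARGED; the
five registered stubs of `Lines/semiclassical_s2beta.lean`, crux 20520 and `YM3TorusSU2` are NOT proved; registry untouched; rung R3 = SU(2) YM₃ on T³ — NOT
d = 4, NOT infinite volume, NOT a mass gap, NOT Clay; the Yang–Mills mass gap is NOT proved.  [folklore]

References: T. Bałaban, CMP **99** (1985) 389–434 [Balaban1985BackgroundPropagators] (Thm 3.4 p.400, Thm 3.11 p.416, Thm 3.12 p.423, p.428); CMP **109** (1987)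
249–301 [Balaban1987RG1] ((1.5) p.261, (1.11)–(1.18) pp.262–263, (3.15)–(3.17) p.273); CMP **116** (1988) 1–22 [Balaban1988RG2Cluster] (p.15).
-/

set_option autoImplicit false

noncomputable section

namespace Summit.QuantumFields.YangMills.Theorems.OrganTangentCornerInversesOfRealCoercive

open Metric Set Finset
-- INSTANCES (LEAD №74 (i)): `Matrix n n ℂ` is normed here by Mathlib's SCOPED `L²`-operator-norm family (`Matrix.instL2OpNormedAddCommGroup ∕
-- …NormedSpace ∕ …NormedRing ∕ …NormedAlgebra`), activated FILE-LOCALLY by the `open scoped` below — the same `open scoped Matrix.Norms.L2Operator`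
-- that ✓p828173's own header carries; no `instance` is declared and no attribute is added, so nothing leaks to importers.
open scoped Matrix Matrix.Norms.L2Operator
open Literature.MathematicalPhysics.QuantumFieldTheory.Balaban1983to89
open Literature.MathematicalPhysics.QuantumFieldTheory.Balaban1983to89.QGQInverse (Coercive)
open Literature.MathematicalPhysics.QuantumFieldTheory.Balaban1983to89.B13RealSliceEntryLetters (accretive_of_coercive_sub)
open Literature.MathematicalPhysics.QuantumFieldTheory.Balaban1983to89.B13Sqrt27Accretive (resolvent_bound_of_accretive)

/-! ## §0 Lax–Milgram for an accretive matrix; one corner's letters from real coercivity -/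

section Generic

variable {n : Type} [Fintype n] [DecidableEq n]

omit [DecidableEq n] in
/-- **REAL COERCIVE ⟹ COMPLEX ACCRETIVE, SAME MARGIN**: `Coercive T₀ γ` (real quadratic form) ⟹ `T₀.map ofReal` is `γ`-accretive in the lane's text
(lit ✓`accretive_of_coercive_sub` at zero deviation). [folklore] [cite: Balaban1988RG2Cluster, p.15; Balaban1985BackgroundPropagators, p.428] -/
theorem accretive_map_of_coercive {T₀ : Matrix n n ℝ} {γ : ℝ} (hc : Coercive T₀ γ) :
    ∀ v : n → ℂ, γ * ∑ i, ‖v i‖ ^ 2 ≤ (∑ i, star (v i) * (T₀.map (algebraMap ℝ ℂ) *ᵥ v) i).re := by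
  have h := accretive_of_coercive_sub (E := ℂ) (A := fun _ : ℂ => T₀.map (algebraMap ℝ ℂ)) (s := Set.univ) hc le_rfl
    (fun u _ i => by simp [Matrix.map_apply]) (fun u _ j => by simp [Matrix.map_apply])
  intro v
  have := h 0 (Set.mem_univ _) v
  simpa using this

/-- **AN ACCRETIVE MATRIX IS INVERTIBLE** (`IsUnit A.det`; lit ✓`resolvent_bound_of_accretive` at spectral parameter `0`). [folklore]
[cite: Balaban1985BackgroundPropagators, Thm 3.4 p.400] -/
theorem isUnit_det_of_accretive {A : Matrix n n ℂ} {m : ℝ} (hm : 0 < m)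
    (hacc : ∀ v : n → ℂ, m * ∑ i, ‖v i‖ ^ 2 ≤ (∑ i, star (v i) * (A *ᵥ v) i).re) : IsUnit A.det := by
  have h := resolvent_bound_of_accretive A hm hacc (le_refl (0:ℝ))
  rw [Complex.ofReal_zero, zero_smul, zero_add] at h
  exact h.1

omit [DecidableEq n] in
/-- **THE LOWER BOUND IN SQUARES**: `m`-accretive ⟹ `m²·Σ‖v i‖² ≤ Σ‖(A v) i‖²` (Cauchy–Schwarz on `Re Σ v̄ᵢ(Av)ᵢ ≤ √Σ‖v‖²·√Σ‖Av‖²`). [folklore]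
[cite: Balaban1985BackgroundPropagators, Thm 3.11 p.416] -/
theorem sq_sum_le_of_accretive {A : Matrix n n ℂ} {m : ℝ} (hm : 0 < m)
    (hacc : ∀ v : n → ℂ, m * ∑ i, ‖v i‖ ^ 2 ≤ (∑ i, star (v i) * (A *ᵥ v) i).re) (v : n → ℂ) :
    m ^ 2 * ∑ i, ‖v i‖ ^ 2 ≤ ∑ i, ‖(A *ᵥ v) i‖ ^ 2 := by
  -- Cauchy–Schwarz: Re Σ v̄ᵢ wᵢ ≤ √(Σ|v|²) √(Σ|w|²)
  set S := ∑ i, ‖v i‖ ^ 2 with hS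
  set T := ∑ i, ‖(A *ᵥ v) i‖ ^ 2 with hT
  have hS0 : 0 ≤ S := sum_nonneg fun i _ => by positivity
  have hT0 : 0 ≤ T := sum_nonneg fun i _ => by positivity
  have hcs : (∑ i, star (v i) * (A *ᵥ v) i).re ≤ Real.sqrt S * Real.sqrt T := by
    calc (∑ i, star (v i) * (A *ᵥ v) i).re ≤ ‖∑ i, star (v i) * (A *ᵥ v) i‖ := Complex.re_le_norm _
      _ ≤ ∑ i, ‖star (v i) * (A *ᵥ v) i‖ := norm_sum_le _ _
      _ = ∑ i, ‖v i‖ * ‖(A *ᵥ v) i‖ := by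
          refine sum_congr rfl fun i _ => ?_; rw [norm_mul, norm_star]
      _ ≤ Real.sqrt (∑ i, ‖v i‖ ^ 2) * Real.sqrt (∑ i, ‖(A *ᵥ v) i‖ ^ 2) :=
          Real.sum_mul_le_sqrt_mul_sqrt _ _ _
      _ = Real.sqrt S * Real.sqrt T := rfl
  have h1 : m * S ≤ Real.sqrt S * Real.sqrt T := (hacc v).trans hcs
  -- square both sides after factoring √S
  by_cases hS00 : S = 0
  · rw [hS00, mul_zero]; exact hT0
  have hSpos : 0 < S := lt_of_le_of_ne hS0 (Ne.symm hS00)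
  have hsq : Real.sqrt S * Real.sqrt S = S := Real.mul_self_sqrt hS0
  have h2 : m * Real.sqrt S ≤ Real.sqrt T := by
    have hsp : 0 < Real.sqrt S := Real.sqrt_pos.2 hSpos
    have h3 : m * Real.sqrt S * Real.sqrt S ≤ Real.sqrt T * Real.sqrt S := by
      rw [mul_assoc, hsq, mul_comm (Real.sqrt T)]; exact h1
    exact le_of_mul_le_mul_right h3 hsp
  have h4 : (m * Real.sqrt S) ^ 2 ≤ (Real.sqrt T) ^ 2 :=
    pow_le_pow_left₀ (mul_nonneg hm.le (Real.sqrt_nonneg _)) h2 2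
  rw [mul_pow, Real.sq_sqrt hS0, Real.sq_sqrt hT0] at h4
  exact h4

/-- ★ **LAX–MILGRAM FOR AN ACCRETIVE MATRIX, `L²`-OPERATOR NORM**: `m`-accretive, `0 < m` ⟹ `‖A⁻¹‖ ≤ m⁻¹` (`ContinuousLinearMap.opNorm_le_bound` on
`toEuclideanLin A⁻¹`; the square bound at `v := A⁻¹ψ`, `A(A⁻¹ψ) = ψ`).  (xv)-currency twin of the T⁴ spine's `CoerciveInverseTower.opNorm_inv_le_of_coercive`
— adapted, not imported. [folklore] [cite: Balaban1985BackgroundPropagators, Thm 3.11 p.416, p.428] -/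
-- adapted from Summits/QuantumFields/BalabanUV/T4Continuum/Spine/CoerciveInverseTower.lean (`opNorm_inv_le_of_coercive`; outside `Theorems/`, not importable here)
theorem l2_opNorm_inv_le_of_accretive {A : Matrix n n ℂ} {m : ℝ} (hm : 0 < m)
    (hacc : ∀ v : n → ℂ, m * ∑ i, ‖v i‖ ^ 2 ≤ (∑ i, star (v i) * (A *ᵥ v) i).re) : ‖A⁻¹‖ ≤ m⁻¹ := by
  have hdet := isUnit_det_of_accretive hm hacc
  rw [Matrix.l2_opNorm_def]
  refine ContinuousLinearMap.opNorm_le_bound _ (inv_nonneg.2 hm.le) fun ψ => ?_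
  have h1 : ‖((Matrix.toEuclideanLin (𝕜 := ℂ) (m := n) (n := n)).trans LinearMap.toContinuousLinearMap A⁻¹) ψ‖ ^ 2
      = ∑ i, ‖(A⁻¹ *ᵥ (fun j => ψ j)) i‖ ^ 2 := by
    rw [EuclideanSpace.norm_sq_eq]
    rfl
  have h2 : ‖ψ‖ ^ 2 = ∑ j, ‖ψ j‖ ^ 2 := EuclideanSpace.norm_sq_eq ψ
  -- apply the square bound to `v := A⁻¹ ψ`, `A v = ψ`
  have h3 := sq_sum_le_of_accretive hm hacc (A⁻¹ *ᵥ (fun j => ψ j))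
  rw [Matrix.mulVec_mulVec, Matrix.mul_nonsing_inv A hdet, Matrix.one_mulVec] at h3
  rw [← h1, ← h2] at h3
  -- `m² ‖A⁻¹ψ‖² ≤ ‖ψ‖²` ⟹ `‖A⁻¹ψ‖ ≤ m⁻¹ ‖ψ‖`
  have h4 : (m * ‖((Matrix.toEuclideanLin (𝕜 := ℂ) (m := n) (n := n)).trans LinearMap.toContinuousLinearMap A⁻¹) ψ‖) ^ 2 ≤ ‖ψ‖ ^ 2 := by
    rw [mul_pow]; exact h3
  have h5 := (pow_le_pow_iff_left₀ (mul_nonneg hm.le (norm_nonneg _)) (norm_nonneg _) two_ne_zero).mp h4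
  rw [inv_mul_eq_div]
  exact (le_div_iff₀' hm).mpr h5

/-- ★★ **ONE CORNER'S LETTER TRIPLE FROM REAL COERCIVITY**: `Coercive T₀ γ`, `0 < γ` ⟹ for `A := T₀.map ofReal`: `A⁻¹ * A = 1 ∧ A * A⁻¹ = 1 ∧ ‖A⁻¹‖ ≤ γ⁻¹`
— EXACTLY ✓p828173's `(hlW, hrW, hAW)` at `A_W := A⁻¹`, `a := γ⁻¹`. [folklore] [cite: Balaban1985BackgroundPropagators, Thm 3.11 p.416, p.428; Balaban1988RG2Cluster, p.15] -/
theorem cornerInverse_of_coercive {T₀ : Matrix n n ℝ} {γ : ℝ} (hγ : 0 < γ) (hc : Coercive T₀ γ) :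
    (T₀.map (algebraMap ℝ ℂ))⁻¹ * T₀.map (algebraMap ℝ ℂ) = 1 ∧ T₀.map (algebraMap ℝ ℂ) * (T₀.map (algebraMap ℝ ℂ))⁻¹ = 1 ∧
      ‖(T₀.map (algebraMap ℝ ℂ))⁻¹‖ ≤ γ⁻¹ := by
  have hacc := accretive_map_of_coercive hc
  have hdet := isUnit_det_of_accretive hγ hacc
  exact ⟨Matrix.nonsing_inv_mul _ hdet, Matrix.mul_nonsing_inv _ hdet, l2_opNorm_inv_le_of_accretive hγ hacc⟩

end Generic


/-! ## §1 ✓p828173 with the corner letters struck -/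

section Dock

open BalabanUVClass (CplxModel)
open T4CubeChartExp (expPt)
open Summit.QuantumFields.YangMills.Theorems.OrganTangentSquareOfTubeHolomorphic (norm_doubleDiff_inv_mul_le_of_tubeHolo)

variable {P : Params} {j : ℕ} [DecidableEq (PBond P j)]
variable {n : Type} [Fintype n] [DecidableEq n]

/-- ★★★ **THE (xv) POINTWISE BILINEAR BOUND FROM TUBE HOLOMORPHY, CORNERS FROM REAL COERCIVITY** — ✓p828173 `norm_doubleDiff_inv_mul_le_of_tubeHolo` at
`R := Matrix n n ℂ` (`L²`-operator norm) with the twelve corner letters `{AU AV AY AZ} (hlU hrU … hlZ hrZ) (hAU … hAZ)` DELETED and `hγK` + `Kr` + (W-read0)×4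
`hKU hKV hKY hKZ` + (W-coer)×4 `hcU hcV hcY hcZ` in their place; conclusion = ✓p828173's with `A_W := (K (ι W))⁻¹`, `a := γK⁻¹`.
[cite: Balaban1987RG1, (1.18) p.263 and (3.15)-(3.17) p.273; Balaban1985BackgroundPropagators, Thm 3.11 p.416, p.428] -/
theorem norm_doubleDiff_inv_mul_le_of_tubeHolo_coercive
    (U : GaugeField P j (Matrix.specialUnitaryGroup (Fin 2) ℂ)) {δ r MK MH γK : ℝ} (hr0 : 0 < r) (hr : Real.exp (6 * r) ≤ 1 + δ)
    (hγK : 0 < γK)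
    (K H : (PBond P j → Matrix (Fin 2) (Fin 2) ℂ) → Matrix n n ℂ)
    (hK : DifferentiableOn ℂ K ((CplxModel.specialUnitary (Fin 2)).cplxTube δ U))
    (hKM : ∀ W ∈ (CplxModel.specialUnitary (Fin 2)).cplxTube δ U, ‖K W‖ ≤ MK)
    (hH : DifferentiableOn ℂ H ((CplxModel.specialUnitary (Fin 2)).cplxTube δ U))
    (hHM : ∀ W ∈ (CplxModel.specialUnitary (Fin 2)).cplxTube δ U, ‖H W‖ ≤ MH)
    (b b' : PBond P j) (w w' : Fin 3 → ℝ) (hw : ‖w‖ ≤ 1) (hw' : ‖w'‖ ≤ 1)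
    {s t : ℝ} (hs0 : 0 ≤ s) (hsr : s ≤ r / 4) (ht0 : 0 ≤ t) (htr : t ≤ r / 4)
    (V Y Z : GaugeField P j (Matrix.specialUnitaryGroup (Fin 2) ℂ))
    (hV : ∀ e, e ≠ b → V e = U e) (hVb : V b = U b * expPt (s • w))
    (hY : ∀ e, e ≠ b' → Y e = U e) (hYb : Y b' = U b' * expPt (t • w'))
    (hZ : ∀ e, e ≠ b' → Z e = V e) (hZb : Z b' = V b' * expPt (t • w'))
    -- (W-read0) at the four REAL corners + (W-coer): the complexified `K` reads the REAL fluctuation operator, γK-coercive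
    (Kr : GaugeField P j (Matrix.specialUnitaryGroup (Fin 2) ℂ) → Matrix n n ℝ)
    (hKU : K ((CplxModel.specialUnitary (Fin 2)).embed U) = (Kr U).map (algebraMap ℝ ℂ))
    (hKV : K ((CplxModel.specialUnitary (Fin 2)).embed V) = (Kr V).map (algebraMap ℝ ℂ))
    (hKY : K ((CplxModel.specialUnitary (Fin 2)).embed Y) = (Kr Y).map (algebraMap ℝ ℂ))
    (hKZ : K ((CplxModel.specialUnitary (Fin 2)).embed Z) = (Kr Z).map (algebraMap ℝ ℂ))
    (hcU : Coercive (Kr U) γK) (hcV : Coercive (Kr V) γK) (hcY : Coercive (Kr Y) γK) (hcZ : Coercive (Kr Z) γK) :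
    ‖(K ((CplxModel.specialUnitary (Fin 2)).embed Z))⁻¹ * H ((CplxModel.specialUnitary (Fin 2)).embed Z)
        - (K ((CplxModel.specialUnitary (Fin 2)).embed V))⁻¹ * H ((CplxModel.specialUnitary (Fin 2)).embed V)
        - (K ((CplxModel.specialUnitary (Fin 2)).embed Y))⁻¹ * H ((CplxModel.specialUnitary (Fin 2)).embed Y)
        + (K ((CplxModel.specialUnitary (Fin 2)).embed U))⁻¹ * H ((CplxModel.specialUnitary (Fin 2)).embed U)‖ ≤
      (γK⁻¹ * (16 * MH / (r * r)) + γK⁻¹ ^ 2 * ((4 * MK / r) * (4 * MH / r) + (4 * MK / r) * (4 * MH / r)) +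
        (γK⁻¹ ^ 2 * (16 * MK / (r * r)) + 2 * γK⁻¹ ^ 3 * (4 * MK / r) * (4 * MK / r)) * MH) * s * t := by
  have eU := cornerInverse_of_coercive hγK hcU
  have eV := cornerInverse_of_coercive hγK hcV
  have eY := cornerInverse_of_coercive hγK hcY
  have eZ := cornerInverse_of_coercive hγK hcZ
  rw [← hKU] at eU; rw [← hKV] at eV; rw [← hKY] at eY; rw [← hKZ] at eZ
  exact norm_doubleDiff_inv_mul_le_of_tubeHolo U hr0 hr K H hK hKM hH hHM b b' w w' hw hw' hs0 hsr ht0 htr V Y Z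
    hV hVb hY hYb hZ hZb eU.1 eU.2.1 eV.1 eV.2.1 eY.1 eY.2.1 eZ.1 eZ.2.1 eU.2.2 eV.2.2 eY.2.2 eZ.2.2

end Dock

end Summit.QuantumFields.YangMills.Theorems.OrganTangentCornerInversesOfRealCoercive

end
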